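import Literature.Analysis.ODE.EvolutionMapSmooth
import Literature.Analysis.FunctionSpaces.FlatTorus
import HarnessLib

/-!
# K3L `LagrangianCarrierConstruction` (stmt-AnomalousDissipation-24913), line `birth`, stub `stub_flowsL`:
# flow calculus of piecewise-smooth uniformly Lipschitz fields (helper; `--supports stmt-AnomalousDissipation-24913`)

Summits-side helper file (everything proved; no definitions, no named facts). First brick of the Lagrangian insertion
`stub_flowsL` (for ANY carrier datum `E` there are level fields `b` and displacements `disp` with `E.IsLagrangian`), built on
the tree's Cauchy–Lipschitz evolution map `Literature.Analysis.ODE.evolutionMap` (`EvolutionMap.lean`,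
`EvolutionMapSmooth.lean`). The Eulerian lattice-shear level fields are continuous and piecewise AFFINE in time (trapezoidal
slot envelopes) and smooth in space; the velocity fields met along the Lagrangian tower are moreover restarted on refresh
windows. The flows needed are therefore those of fields `v : ℝ → V → V` that are uniformly Lipschitz (Cauchy–Lipschitz
hypotheses on all of `ℝ`) and SMOOTH ON ONE-SIDED TIME SLABS `[r, r+ε] × V`, `[r−ε, r] × V` around every time `r`:
* `forall_of_chain_local` — a reflexive transitive relation on `ℝ` that holds locally (both ways near every point) holds
  globally (clopen argument on the connected line; it replaces any enumeration of the break times);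
* `contDiff_evolutionMap_of_local` — every evolution map `z ↦ φ(t, s, z)` of such a field is `C^n`, for ALL pairs of times
  (the break times in between are chained over); so is its inverse `φ(s, t, ·)`;
* `contDiffOn_evolutionMap_uncurry_of_local` / `contDiffAt_evolutionMap_uncurry_of_local` — joint smoothness of
  `(t, z) ↦ φ(t, s, z)` on `S × V` for every time slab `S ∋ r` on which the field is smooth and EVERY initial time `s`
  (group law through `r`), in particular joint `C^n` at `(t, z)` when the field is smooth on a two-sided slab around `t`;
* `evolutionMap_add_latticeVec` — for a lattice-periodic field on `ℝ^d` the evolution maps are lattice-EQUIVARIANT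
  (`φ(t, s, z + n) = φ(t, s, z) + n`), i.e. they descend to the flat torus;
* `exists_lipschitzWith_evolutionMap_Icc` — one Lipschitz constant in `z` for all pairs of times in a compact interval, and
  the resulting bound on the derivative `‖D φ(t, s, ·)‖`.
This is infrastructure for the construction side of route-1's rung leaf F-D1.A0 (a frontier formal rung); it is NOT a proof of
anomalous dissipation.
-/

set_option linter.dupNamespace false

noncomputable section

namespace Summit.AnomalousDissipation.AnomalousDissipation.Theorems.SolenoidalFractalHomogenisation.LagrangianCarrierConstruction

open Set Function Filter Topology Metric
open scoped NNReal
open Literature.Analysis.ODE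

section Chain

/-- **Chaining a local two-way relation along the line.** A reflexive, transitive relation `P` on `ℝ` such that every
point `r` has a neighbourhood all of whose points are `P`-related to `r` both ways holds between ANY two reals (the set
`{t | P s t ∧ P t s}` is clopen and nonempty in the connected space `ℝ`). [folklore] -/
theorem forall_of_chain_local {P : ℝ → ℝ → Prop} (hrefl : ∀ s, P s s)
    (htrans : ∀ r s t, P r s → P s t → P r t)
    (hloc : ∀ r, ∃ ε > 0, ∀ t, dist t r < ε → P r t ∧ P t r) : ∀ s t, P s t := by
  intro s
  have hopen : IsOpen {t | P s t ∧ P t s} := by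
    rw [Metric.isOpen_iff]
    rintro t ⟨h1, h2⟩
    obtain ⟨ε, hε, hε'⟩ := hloc t
    exact ⟨ε, hε, fun t' ht' => ⟨htrans _ _ _ h1 (hε' t' ht').1, htrans _ _ _ (hε' t' ht').2 h2⟩⟩
  have hclosed : IsClosed {t | P s t ∧ P t s} := by
    rw [← closure_subset_iff_isClosed]
    intro t ht
    obtain ⟨ε, hε, hε'⟩ := hloc t
    obtain ⟨t', ht'G, ht'd⟩ := Metric.mem_closure_iff.1 ht ε hε
    have h := hε' t' (by rwa [dist_comm])
    exact ⟨htrans _ _ _ ht'G.1 h.2, htrans _ _ _ h.1 ht'G.2⟩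
  have huniv : {t | P s t ∧ P t s} = univ := IsClopen.eq_univ ⟨hclosed, hopen⟩ ⟨s, hrefl s, hrefl s⟩
  intro t
  have ht : t ∈ {t | P s t ∧ P t s} := by rw [huniv]; trivial
  exact ht.1

end Chain

section Smooth

variable {V : Type*} [NormedAddCommGroup V] [NormedSpace ℝ V] [CompleteSpace V]
variable {v : ℝ → V → V} {n : ℕ∞}

/-- **Evolution maps of a field smooth on one-sided time slabs are smooth, for all pairs of times.** If `v` satisfies the
Cauchy–Lipschitz hypotheses on `ℝ` and around every time `r` is `C^n` (`n ≥ 1`) on the slabs `[r, r+ε] × V` and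
`[r−ε, r] × V`, then every `z ↦ φ(t, s, z)` is `C^n` (Hartman Cor. V.4.1 on each slab, chained across the break times by the
two-parameter group law). [folklore] -/
theorem contDiff_evolutionMap_of_local (hv : IsUniformlyLipschitzOn v univ) (hn : 1 ≤ n)
    (hloc : ∀ r : ℝ, ∃ ε > 0, ContDiffOn ℝ n (uncurry v) (Icc r (r + ε) ×ˢ univ) ∧
      ContDiffOn ℝ n (uncurry v) (Icc (r - ε) r ×ˢ univ)) (s t : ℝ) :
    ContDiff ℝ n (evolutionMap v s t) := by
  refine forall_of_chain_local (P := fun s t => ContDiff ℝ n (evolutionMap v s t)) ?_ ?_ ?_ s t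
  · intro s
    have e : evolutionMap v s s = id := funext fun x => evolutionMap_self v s x
    rw [e]
    exact contDiff_id
  · intro r s t hrs hst
    have e : evolutionMap v r t = evolutionMap v s t ∘ evolutionMap v r s := by
      funext x
      exact (hv.evolutionMap_trans convex_univ (mem_univ r) (mem_univ s) (mem_univ t) x).symm
    rw [e]
    exact hst.comp hrs
  · intro r
    obtain ⟨ε, hε, hp, hm⟩ := hloc r
    have key : ∀ S : Set ℝ, Convex ℝ S → UniqueDiffOn ℝ S → ContDiffOn ℝ n (uncurry v) (S ×ˢ univ) →
        ∀ a ∈ S, ∀ b ∈ S, ContDiff ℝ n (evolutionMap v a b) := fun S hS hSu hvS a ha b hb =>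
      (hv.mono (subset_univ S)).contDiff_evolutionMap hS hSu hn hvS ha hb
    refine ⟨ε, hε, fun t ht => ?_⟩
    rw [Real.dist_eq, abs_lt] at ht
    rcases le_or_gt r t with hrt | htr
    · have ht' : t ∈ Icc r (r + ε) := ⟨hrt, by linarith [ht.2]⟩
      have hr' : r ∈ Icc r (r + ε) := ⟨le_rfl, by linarith⟩
      exact ⟨key _ (convex_Icc _ _) (uniqueDiffOn_Icc (by linarith)) hp r hr' t ht',
        key _ (convex_Icc _ _) (uniqueDiffOn_Icc (by linarith)) hp t ht' r hr'⟩
    · have ht' : t ∈ Icc (r - ε) r := ⟨by linarith [ht.1], htr.le⟩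
      have hr' : r ∈ Icc (r - ε) r := ⟨by linarith, le_rfl⟩
      exact ⟨key _ (convex_Icc _ _) (uniqueDiffOn_Icc (by linarith)) hm r hr' t ht',
        key _ (convex_Icc _ _) (uniqueDiffOn_Icc (by linarith)) hm t ht' r hr'⟩

/-- **Joint smoothness in `(t, z)` on a smooth slab, for every initial time.** Under the same hypotheses, if `v` is `C^n`
on `S × V` for a convex set of times `S` with the unique differentiability property (a closed slab `[r₁, r₂]`, say) then
for EVERY initial time `s` (inside or outside `S`) the map `(t, z) ↦ φ(t, s, z)` is `C^n` on `S × V`: route it through a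
time `r ∈ S`, `φ(t, s, ·) = φ(t, r, ·) ∘ φ(r, s, ·)`. [folklore] -/
theorem contDiffOn_evolutionMap_uncurry_of_local (hv : IsUniformlyLipschitzOn v univ) (hn : 1 ≤ n)
    (hloc : ∀ r : ℝ, ∃ ε > 0, ContDiffOn ℝ n (uncurry v) (Icc r (r + ε) ×ˢ univ) ∧
      ContDiffOn ℝ n (uncurry v) (Icc (r - ε) r ×ˢ univ))
    {S : Set ℝ} (hS : Convex ℝ S) (hSu : UniqueDiffOn ℝ S) (hvS : ContDiffOn ℝ n (uncurry v) (S ×ˢ univ))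
    {r : ℝ} (hr : r ∈ S) (s : ℝ) :
    ContDiffOn ℝ n (fun p : ℝ × V => evolutionMap v s p.1 p.2) (S ×ˢ univ) := by
  have h1 := (hv.mono (subset_univ S)).contDiffOn_evolutionMap_uncurry hS hSu hn hvS hr
  have hE : ContDiff ℝ n (evolutionMap v s r) := contDiff_evolutionMap_of_local hv hn hloc s r
  have hg : ContDiffOn ℝ n (fun p : ℝ × V => ((p.1, evolutionMap v s r p.2) : ℝ × V)) (S ×ˢ univ) :=
    (contDiff_fst.prodMk (hE.comp contDiff_snd)).contDiffOn
  have hmaps : MapsTo (fun p : ℝ × V => ((p.1, evolutionMap v s r p.2) : ℝ × V)) (S ×ˢ univ) (S ×ˢ univ) :=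
    fun p hp => ⟨hp.1, mem_univ _⟩
  refine (h1.comp hg hmaps).congr fun p _ => ?_
  simp only [comp_apply]
  exact (hv.evolutionMap_trans convex_univ (mem_univ s) (mem_univ r) (mem_univ p.1) p.2).symm

/-- Joint `C^n`-ness of `(t, z) ↦ φ(t, s, z)` at `(t, z)` when the field is `C^n` on a two-sided slab `[t−ε, t+ε] × V`
(any initial time `s`). [folklore] -/
theorem contDiffAt_evolutionMap_uncurry_of_local (hv : IsUniformlyLipschitzOn v univ) (hn : 1 ≤ n)
    (hloc : ∀ r : ℝ, ∃ ε > 0, ContDiffOn ℝ n (uncurry v) (Icc r (r + ε) ×ˢ univ) ∧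
      ContDiffOn ℝ n (uncurry v) (Icc (r - ε) r ×ˢ univ))
    {t ε : ℝ} (hε : 0 < ε) (h2 : ContDiffOn ℝ n (uncurry v) (Icc (t - ε) (t + ε) ×ˢ univ)) (s : ℝ) (z : V) :
    ContDiffAt ℝ n (fun p : ℝ × V => evolutionMap v s p.1 p.2) (t, z) := by
  have ht : t ∈ Icc (t - ε) (t + ε) := ⟨by linarith, by linarith⟩
  have h := contDiffOn_evolutionMap_uncurry_of_local hv hn hloc (convex_Icc _ _)
    (uniqueDiffOn_Icc (by linarith)) h2 ht s
  refine h.contDiffAt (prod_mem_nhds (Icc_mem_nhds (by linarith) (by linarith)) univ_mem)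

/-- The time derivative of the evolution map at every time: `∂ₜ φ(t, s, z) = v(t, φ(t, s, z))` (two-sided, the field being
defined on all of `ℝ`). [folklore] -/
theorem hasDerivAt_evolutionMap_univ (hv : IsUniformlyLipschitzOn v univ) (s t : ℝ) (z : V) :
    HasDerivAt (fun τ => evolutionMap v s τ z) (v t (evolutionMap v s t z)) t :=
  hv.hasDerivAt_evolutionMap convex_univ (mem_univ s) univ_mem z

/-- The evolution is continuous in time (every initial time and point). [folklore] -/
theorem continuous_evolutionMap_univ (hv : IsUniformlyLipschitzOn v univ) (s : ℝ) (z : V) :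
    Continuous fun τ => evolutionMap v s τ z :=
  continuous_iff_continuousAt.2 fun t => (hasDerivAt_evolutionMap_univ hv s t z).continuousAt

/-- Group law and inverses on all of `ℝ` (restated for fields given on the whole line). [folklore] -/
theorem evolutionMap_trans_univ (hv : IsUniformlyLipschitzOn v univ) (r s t : ℝ) (z : V) :
    evolutionMap v s t (evolutionMap v r s z) = evolutionMap v r t z :=
  hv.evolutionMap_trans convex_univ (mem_univ r) (mem_univ s) (mem_univ t) z

/-- `φ(s, t, φ(t, s, z)) = z`. [folklore] -/
theorem evolutionMap_symm_univ (hv : IsUniformlyLipschitzOn v univ) (s t : ℝ) (z : V) :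
    evolutionMap v t s (evolutionMap v s t z) = z :=
  hv.evolutionMap_symm convex_univ (mem_univ s) (mem_univ t) z

/-- **One Lipschitz constant in `z` for all pairs of times in a compact interval** (Teschl (2.43) with the spatial Lipschitz
constant of `[a, b]`). [folklore] -/
theorem exists_lipschitzWith_evolutionMap_Icc (hv : IsUniformlyLipschitzOn v univ) (a b : ℝ) :
    ∃ K : ℝ≥0, ∀ s ∈ Icc a b, ∀ t ∈ Icc a b, LipschitzWith K (evolutionMap v s t) := by
  rcases le_or_gt a b with hab | hba
  · obtain ⟨K, hK⟩ := hv.exists_lipschitzWith_Icc convex_univ (mem_univ a) (mem_univ b)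
    refine ⟨(Real.exp (K * (b - a))).toNNReal, fun s hs t ht => LipschitzWith.of_dist_le_mul fun x y => ?_⟩
    have hsub : uIcc s t ⊆ Icc a b := (ordConnected_Icc).uIcc_subset hs ht
    have h := hv.dist_evolutionMap_le convex_univ (mem_univ s) (mem_univ t) (fun r hr => hK r (hsub hr)) x y
    have hexp : Real.exp (K * |t - s|) ≤ Real.exp (K * (b - a)) := by
      refine Real.exp_le_exp.2 (mul_le_mul_of_nonneg_left ?_ K.2)
      rw [abs_le]; constructor <;> linarith [hs.1, hs.2, ht.1, ht.2]
    rw [Real.coe_toNNReal _ (Real.exp_pos _).le]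
    calc dist (evolutionMap v s t x) (evolutionMap v s t y) ≤ dist x y * Real.exp (K * |t - s|) := h
      _ ≤ dist x y * Real.exp (K * (b - a)) := mul_le_mul_of_nonneg_left hexp dist_nonneg
      _ = Real.exp (K * (b - a)) * dist x y := mul_comm _ _
  · exact ⟨0, fun s hs t ht => absurd (le_trans hs.1 hs.2) (not_le.2 hba)⟩

omit [CompleteSpace V] in
/-- A Lipschitz map has derivative bounded by its Lipschitz constant. [folklore] -/
theorem norm_fderiv_le_of_lipschitzWith {f : V → V} {K : ℝ≥0} (hf : LipschitzWith K f) (z : V) :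
    ‖fderiv ℝ f z‖ ≤ K :=
  norm_fderiv_le_of_lipschitz ℝ hf

end Smooth

section Periodic

open Literature.Analysis.FunctionSpaces

variable {d : Type*} [Fintype d] [DecidableEq d]
variable {v : ℝ → EuclideanSpace ℝ d → EuclideanSpace ℝ d}

/-- **Lattice-periodic fields have lattice-equivariant evolution maps**: if `v(t, z + n) = v(t, z)` for all lattice
vectors `n ∈ ℤ^d` then `φ(t, s, z + n) = φ(t, s, z) + n` (both sides solve the equation through `z + n` at time `s`;
uniqueness). Hence the evolution descends to the flat torus `ℝ^d/ℤ^d`. [folklore] -/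
theorem evolutionMap_add_latticeVec (hv : IsUniformlyLipschitzOn v univ)
    (hper : ∀ t z (k : d → ℤ), v t (z + Torus.latticeVec k) = v t z) (s t : ℝ)
    (z : EuclideanSpace ℝ d) (k : d → ℤ) :
    evolutionMap v s t (z + Torus.latticeVec k) = evolutionMap v s t z + Torus.latticeVec k := by
  have hγ : ∀ τ ∈ (univ : Set ℝ), HasDerivWithinAt (fun τ => evolutionMap v s τ z + Torus.latticeVec k)
      (v τ (evolutionMap v s τ z + Torus.latticeVec k)) univ τ := by
    intro τ _
    rw [hper]
    exact (hv.hasDerivWithinAt_evolutionMap convex_univ (mem_univ s) (mem_univ τ) z).add_const _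
  have h := hv.evolutionMap_eq convex_univ (mem_univ s) hγ (mem_univ t)
  simpa using h

/-- A lattice-periodic field in the tree's sense (`IsLatticePeriodic`, periodicity under the basis vectors) is invariant
under all lattice translations at every time. [folklore] -/
theorem forall_add_latticeVec_of_isLatticePeriodic (hper : ∀ t, Torus.IsLatticePeriodic (v t)) (t : ℝ)
    (z : EuclideanSpace ℝ d) (k : d → ℤ) : v t (z + Torus.latticeVec k) = v t z :=
  Torus.IsLatticePeriodic.add_latticeVec_holds (hper t) z k

/-- The inverse of a lattice-equivariant bijection is lattice-equivariant. [folklore] -/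
theorem equivariant_symm {F : EuclideanSpace ℝ d ≃ EuclideanSpace ℝ d}
    (hF : ∀ z (k : d → ℤ), F (z + Torus.latticeVec k) = F z + Torus.latticeVec k)
    (z : EuclideanSpace ℝ d) (k : d → ℤ) : F.symm (z + Torus.latticeVec k) = F.symm z + Torus.latticeVec k := by
  apply F.injective
  rw [hF, F.apply_symm_apply, F.apply_symm_apply]

/-- Composition of lattice-equivariant maps is lattice-equivariant. [folklore] -/
theorem equivariant_comp {F G : EuclideanSpace ℝ d → EuclideanSpace ℝ d}
    (hF : ∀ z (k : d → ℤ), F (z + Torus.latticeVec k) = F z + Torus.latticeVec k)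
    (hG : ∀ z (k : d → ℤ), G (z + Torus.latticeVec k) = G z + Torus.latticeVec k)
    (z : EuclideanSpace ℝ d) (k : d → ℤ) : G (F (z + Torus.latticeVec k)) = G (F z) + Torus.latticeVec k := by
  rw [hF, hG]

/-- The displacement `F − id` of a lattice-equivariant map is lattice-periodic (so it is the lift of a function on the
torus). [folklore] -/
theorem isLatticePeriodic_sub_of_equivariant {F : EuclideanSpace ℝ d → EuclideanSpace ℝ d}
    (hF : ∀ z (k : d → ℤ), F (z + Torus.latticeVec k) = F z + Torus.latticeVec k) :
    Torus.IsLatticePeriodic fun z => F z - z := by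
  intro j z
  have h := hF z (Pi.single j 1)
  rw [Torus.latticeVec_single] at h
  simp only [h]
  abel

/-- The derivative of a lattice-equivariant map is lattice-periodic. [folklore] -/
theorem fderiv_add_latticeVec_of_equivariant {F : EuclideanSpace ℝ d → EuclideanSpace ℝ d}
    (hF : ∀ z (k : d → ℤ), F (z + Torus.latticeVec k) = F z + Torus.latticeVec k)
    (z : EuclideanSpace ℝ d) (k : d → ℤ) : fderiv ℝ F (z + Torus.latticeVec k) = fderiv ℝ F z := by
  have e : F = fun y => F (y + Torus.latticeVec k) - Torus.latticeVec k := by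
    funext y; rw [hF]; abel
  conv_rhs => rw [e]
  rw [fderiv_sub_const, fderiv_comp_add_right]

end Periodic

end Summit.AnomalousDissipation.AnomalousDissipation.Theorems.SolenoidalFractalHomogenisation.LagrangianCarrierConstruction

end
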